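import Summits.AtomisticToContinuum.HydrodynamicLimit.Theorems.CorrectorPressureDecay.Negative.DiscreteCertificate
import Summits.AtomisticToContinuum.HydrodynamicLimit.Theorems.JParityClosureOddContactSymmetryGibbsInvariance
import Literature.Analysis.FluidPDE.HardSphereDynamicsProofs
import Summits.AtomisticToContinuum.HydrodynamicLimit.Theorems.AntiMazurCoboundariesCorrectorPressureDecayDiscreteFejer

/-!
# Negative knowledge for `CorrectorPressureDecay` (stmt-AtomisticToContinuum-14135): the crux implies
discrete-window pressure decay, hence the line's open stub (drefute gen 3, file 2/2)

Refuter `refuter-drefute-stmt-AtomisticToContinuum-14135-g3-0` (drefute gen 3 of the registered line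
`Cruxes/CorrectorPressureDecay/Lines/kinetic-entropy-collision-budget.lean`), 2026-08-16. WHAT IS PROVED (sorry-free):

  `discreteWindowPressureDecay_of_correctorPressureDecay : CorrectorPressureDecay → DiscreteWindowPressureDecay`
  `fastSectorDominance_of_correctorPressureDecay : OneBodyEntropyBudget → CorrectorPressureDecay → FastSectorDominance`

where `CorrectorPressureDecay` is the crux X itself (route decl, BY NAME) and `DiscreteWindowPressureDecay`,
`FastSectorDominance` (= the line's open stub 5, verbatim) and `OneBodyEntropyBudget` (= the line's stub 2, verbatim,
TRUE) are the statements of `Negative/FastSectorSandwichFrame.lean` (drefute gen 2). Together with the skeleton's own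
sorry-free composition (stubs 1, 2, 3, 6 + stub 5 ⇒ X; stubs 1, 3, 4, 6 are landed tree theorems) this closes, INSIDE
LEAN and without the shared wall 10967 or any continuous-window / joint-measurability / Riemann-sum argument, the loop
`X ⇒ DiscreteWindowPressureDecay ⇒ FastSectorDominance ⇒ X` (given the true stub 2): the open stub of the line is
EQUIVALENT to the crux; and X is equivalent to plain discrete-window pressure decay of fast one-body observables
(`DiscreteWindowPressureDecay ⇒ X` is the landed stub 6, `stub_discreteFejerCorrector`): the corrector / lag freedom
of X buys nothing.

MECHANISM. (1) the DISCRETE CERTIFICATE of file 1/2, transferred to `Φ.flow` along `μ(goodᶜ) = 0` via `flowMod Φ`;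
(2) RIGHT-CONTINUITY OF THE KOOPMAN SHIFT: `∫|F∘Φ_u − F| dμ → 0` as `u ↓ 0` for continuous bounded `F` (good orbits
are right-continuous, dominated convergence) and `∫|F∘Φ_{u+t} − F∘Φ_t| dμ = ∫|F∘Φ_u − F| dμ` (invariance); (3) given
X for the admissible observable `4g` at `δ := η` (corrector `W`, `lag`, cost scale `τ₀ℓ_N`) and `H ≥ H₁ := τ₀`, for
`n ≥ n₀(N, Φ)` put `m := ⌊n·lag/(Hℓ_N)⌋`: the certificate at spacing `lag/m ≥ Hℓ_N/n` is `≤ e^{η(N+1)}` (defect;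
cost because `n·lag/m ≥ τ₀ℓ_N`) and its samples sit to the RIGHT of the window samples by `≤ Hℓ_N/m → 0`, whence
`∫ exp(2A_n) ≤ (∫ exp(4A'_n))^½ (∫ exp(4(A_n − A'_n)))^½ ≤ e^{η(N+1)}`. Nothing here asserts a Theses decl.
-/

noncomputable section

open MeasureTheory ProbabilityTheory InformationTheory Set Filter Topology
open scoped ENNReal

namespace Summit.AtomisticToContinuum.HydrodynamicLimit.Theorems.CorrectorPressureDecayNegative.DiscreteWindow

open Literature.MathematicalPhysics.KineticTheory (T3 V3 hsDiameter localGibbsLaw)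
open Literature.Analysis.FluidPDE (HardSphereFlow Config)
open Summit.AtomisticToContinuum.HydrodynamicLimit.Theorems.CorrectorPressureDecayNegative.FastSectorSandwich
open Summit.AtomisticToContinuum.HydrodynamicLimit.Theorems.BoltzmannGreenKuboOrthMomentum
  (flowMod flowMod_of_mem measurable_flowMod)
open Summit.AtomisticToContinuum.HydrodynamicLimit.Theorems.AntiMazurCoboundariesExponentialCertificate
  (flowMod_add measurePreserving_flowMod)

/-! ## Hard-sphere flows: the certificate, right-continuity of the Koopman shift -/

section Concrete

variable {σ : ℝ} {N : ℕ}

/-- **The discrete exponential certificate for a hard-sphere flow**: for a flow-invariant probability law not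
charging the bad set, measurable `F, W`, `lag > 0`, `m, n ≥ 1`,
`∫ exp(A'_n) dμ ≤ (∫ exp(2(F − lag⁻¹(W∘Φ_lag − W))) dμ)^½ (∫ exp((4m/(n·lag))|W|) dμ)^½`,
`A'_n = n⁻¹ Σ_{j=1}^{n} F∘Φ_{j·lag/m}` (the abstract certificate for the modified flow `flowMod Φ`, transferred
along `μ(goodᶜ) = 0`). [folklore] -/
theorem discreteCertificate (Φ : Flow σ N) (μ : Measure (Phase N)) [IsProbabilityMeasure μ]
    (hinv : ∀ t, MeasurePreserving (Φ.flow t) μ μ) (hgood : μ Φ.goodᶜ = 0) {F W : Phase N → ℝ}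
    (hF : Measurable F) (hW : Measurable W) {lag : ℝ} (hlag : 0 < lag) {m n : ℕ} (hm : 1 ≤ m) (hn : 1 ≤ n) :
    ∫⁻ z, ENNReal.ofReal (Real.exp (discAvg Φ F n (lag / m) z)) ∂μ ≤
      (∫⁻ z, ENNReal.ofReal (Real.exp (2 * (F z - lag⁻¹ * (W (Φ.flow lag z) - W z)))) ∂μ) ^ (1 / 2 : ℝ) *
        (∫⁻ z, ENNReal.ofReal (Real.exp (4 * m / (n * lag) * |W z|)) ∂μ) ^ (1 / 2 : ℝ) := by
  have hae : ∀ᵐ z ∂μ, z ∈ Φ.good := (mem_ae_iff.2 hgood : Φ.good ∈ ae μ)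
  have core := discreteCertificate_of_semigroup (flowMod Φ)
    (fun t => (measurable_flowMod Φ).comp measurable_prodMk_left) (flowMod_add Φ) μ
    (measurePreserving_flowMod Φ μ hinv hgood) hF hW hlag hm hn
  have lhs : ∫⁻ z, ENNReal.ofReal (Real.exp (discAvg Φ F n (lag / m) z)) ∂μ =
      ∫⁻ z, ENNReal.ofReal (Real.exp ((n : ℝ)⁻¹ *
        ∑ j : Fin n, F (flowMod Φ ((((j : ℕ) : ℝ) + 1) * (lag / m), z)))) ∂μ := by
    refine lintegral_congr_ae ?_
    filter_upwards [hae] with z hz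
    simp only [discAvg, flowMod_of_mem Φ hz]
  have rhs : ∫⁻ z, ENNReal.ofReal (Real.exp (2 * (F z - lag⁻¹ * (W (Φ.flow lag z) - W z)))) ∂μ =
      ∫⁻ z, ENNReal.ofReal (Real.exp (2 * (F z - lag⁻¹ * (W (flowMod Φ (lag, z)) - W z)))) ∂μ := by
    refine lintegral_congr_ae ?_
    filter_upwards [hae] with z hz
    rw [flowMod_of_mem Φ hz]
  rw [lhs, rhs]
  exact core

/-- **Right-continuity of the Koopman shift in `L¹`**: for a probability law not charging the bad set and a
bounded continuous observable, `∫ |F∘Φ_u − F| dμ → 0` as `u ↓ 0` (good orbits are right-continuous; dominated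
convergence). [folklore] -/
theorem tendsto_lintegral_abs_sub_flow (Φ : Flow σ N) (μ : Measure (Phase N)) [IsFiniteMeasure μ]
    (hgood : μ Φ.goodᶜ = 0) {F : Phase N → ℝ} (hFc : Continuous F) {C : ℝ} (hC : ∀ z, |F z| ≤ C) :
    Tendsto (fun u : ℝ => ∫⁻ z, ENNReal.ofReal |F (Φ.flow u z) - F z| ∂μ) (𝓝[≥] 0) (𝓝 0) := by
  have hFm : Measurable F := hFc.measurable
  have hae : ∀ᵐ z ∂μ, z ∈ Φ.good := (mem_ae_iff.2 hgood : Φ.good ∈ ae μ)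
  have hlim : ∀ᵐ z ∂μ, Tendsto (fun u : ℝ => ENNReal.ofReal |F (Φ.flow u z) - F z|) (𝓝[≥] 0)
      (𝓝 ((fun _ : Phase N => (0 : ℝ≥0∞)) z)) := by
    filter_upwards [hae] with z hz
    have h1 : ContinuousWithinAt (fun u => Φ.flow u z) (Ioi 0) 0 :=
      (Φ.isTrajectory z hz).tendsto_nhdsGT torus_continuous_translate 0
    have h2 : Tendsto (fun u => Φ.flow u z) (𝓝[≥] 0) (𝓝 z) := by
      have h := continuousWithinAt_Ioi_iff_Ici.1 h1
      rw [ContinuousWithinAt, Φ.flow_zero z hz] at h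
      exact h
    have h3 : Tendsto (fun u => F (Φ.flow u z) - F z) (𝓝[≥] 0) (𝓝 0) := by
      have h := ((hFc.tendsto z).comp h2).sub_const (F z)
      simpa using h
    have h4 : Tendsto (fun u => |F (Φ.flow u z) - F z|) (𝓝[≥] 0) (𝓝 0) := by
      simpa using h3.abs
    simpa using ENNReal.tendsto_ofReal h4
  have h := tendsto_lintegral_filter_of_dominated_convergence (μ := μ) (l := 𝓝[≥] (0 : ℝ))
    (F := fun (u : ℝ) (z : Phase N) => ENNReal.ofReal |F (Φ.flow u z) - F z|) (f := fun _ => 0)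
    (fun _ => ENNReal.ofReal (C + C))
    (Eventually.of_forall fun u => ((hFm.comp (Φ.measurable_flow u)).sub hFm).abs.ennreal_ofReal)
    (Eventually.of_forall fun u => ae_of_all _ fun z =>
      ENNReal.ofReal_le_ofReal ((abs_sub _ _).trans (add_le_add (hC _) (hC _))))
    (by rw [lintegral_const]; exact ENNReal.mul_ne_top ENNReal.ofReal_ne_top (measure_ne_top μ _)) hlim
  simpa using h

/-- The modulus form: for every `ε > 0` there is `u₀ > 0` with `∫ |F∘Φ_u − F| dμ ≤ ε` for all `u ∈ [0, u₀]`.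
[folklore] -/
theorem exists_shift_modulus (Φ : Flow σ N) (μ : Measure (Phase N)) [IsFiniteMeasure μ]
    (hgood : μ Φ.goodᶜ = 0) {F : Phase N → ℝ} (hFc : Continuous F) {C : ℝ} (hC : ∀ z, |F z| ≤ C)
    {ε : ℝ≥0∞} (hε : 0 < ε) :
    ∃ u₀ : ℝ, 0 < u₀ ∧ ∀ u ∈ Icc (0 : ℝ) u₀, ∫⁻ z, ENNReal.ofReal |F (Φ.flow u z) - F z| ∂μ ≤ ε := by
  have h := tendsto_lintegral_abs_sub_flow Φ μ hgood hFc hC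
  obtain ⟨δ, hδ, hδε⟩ :=
    Metric.eventually_nhds_iff.1 (eventually_nhdsWithin_iff.1 (h.eventually (gt_mem_nhds hε)))
  refine ⟨δ / 2, half_pos hδ, fun u hu => (hδε ?_ hu.1).le⟩
  rw [Real.dist_eq, sub_zero, abs_of_nonneg hu.1]
  linarith [hu.2]

/-- **Invariance of the shift modulus**: `∫ |F∘Φ_{u+t} − F∘Φ_t| dμ = ∫ |F∘Φ_u − F| dμ` for a flow-invariant law
not charging the bad set. [folklore] -/
theorem lintegral_abs_sub_shift (Φ : Flow σ N) (μ : Measure (Phase N))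
    (hinv : ∀ t, MeasurePreserving (Φ.flow t) μ μ) (hgood : μ Φ.goodᶜ = 0) {F : Phase N → ℝ}
    (hFm : Measurable F) (u t : ℝ) :
    ∫⁻ z, ENNReal.ofReal |F (Φ.flow (u + t) z) - F (Φ.flow t z)| ∂μ =
      ∫⁻ z, ENNReal.ofReal |F (Φ.flow u z) - F z| ∂μ := by
  have hae : ∀ᵐ z ∂μ, z ∈ Φ.good := (mem_ae_iff.2 hgood : Φ.good ∈ ae μ)
  have hm : Measurable fun w => ENNReal.ofReal |F (Φ.flow u w) - F w| :=
    ((hFm.comp (Φ.measurable_flow u)).sub hFm).abs.ennreal_ofReal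
  calc ∫⁻ z, ENNReal.ofReal |F (Φ.flow (u + t) z) - F (Φ.flow t z)| ∂μ
      = ∫⁻ z, (fun w => ENNReal.ofReal |F (Φ.flow u w) - F w|) (Φ.flow t z) ∂μ := by
        refine lintegral_congr_ae ?_
        filter_upwards [hae] with z hz
        simp only [Φ.flow_add u t z hz]
    _ = ∫⁻ z, ENNReal.ofReal |F (Φ.flow u z) - F z| ∂μ := (hinv t).lintegral_comp hm

end Concrete

/-! ## The crux implies discrete-window pressure decay -/

set_option maxHeartbeats 1600000 in
/-- **X ⇒ discrete-window pressure decay.** `CorrectorPressureDecay` (stmt-14135, the crux, BY NAME) implies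
`DiscreteWindowPressureDecay` (drefute gen 2's middle of the sandwich) at amplitude `κ/4`: the crux applied to the
admissible observable `4g` at `δ := η` gives `(τ₀, N₀)` and, for `N ≥ N₀` and each flow, `(lag, W)`; take `H₁ := τ₀`;
for a window `H ≥ H₁` and a sampling `n`, put `m := ⌊n·lag/(Hℓ_N)⌋`; the discrete certificate at spacing `lag/m` is
`≤ e^{η(N+1)}` (defect clause, and cost clause since `n·lag/m ≥ Hℓ_N ≥ τ₀ℓ_N`), and the window samples differ from
the certificate samples by right shifts `≤ Hℓ_N/m`, whose exponential cost tends to `1` as `n → ∞` by the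
right-continuity of the Koopman shift. No 10967, no continuous window, no Riemann sums. [folklore] -/
theorem discreteWindowPressureDecay_of_correctorPressureDecay
    (hX : Summit.AtomisticToContinuum.HydrodynamicLimit.Theses.AntiMazurCoboundaries.CorrectorPressureDecay) :
    DiscreteWindowPressureDecay := by
  intro a θ u₀ ha hθ
  obtain ⟨σ₀, hσ₀, HX⟩ := hX a θ u₀ ha hθ
  refine ⟨σ₀, hσ₀, fun σ hσ hσlt => ?_⟩
  obtain ⟨hP, κ, hκ, Hκ⟩ := HX σ hσ hσlt
  refine ⟨κ / 4, by positivity, fun φ g hφ hg hφ1 hgκ horth η hη => ?_⟩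
  -- the crux for the admissible observable `4g` at `δ := η`
  have hg4c : Continuous fun v => 4 * g v := continuous_const.mul hg
  have hg4b : ∀ v, |4 * g v| ≤ κ := fun v => by
    rw [abs_mul, abs_of_pos (by norm_num : (0 : ℝ) < 4)]
    linarith [hgκ v]
  obtain ⟨τ₀, hτ₀, N₀, HN⟩ := Hκ φ (fun v => 4 * g v) hφ hg4c hφ1 hg4b (orth_const_mul horth 4) η hη
  refine ⟨τ₀, hτ₀, fun H hH => ⟨N₀, fun N hN Φ => ?_⟩⟩
  obtain ⟨lag, hlag, W, hWm, -, hdef, hcost⟩ := HN N hN Φ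
  -- frame objects at fixed `(N, Φ)`
  haveI hGp : IsProbabilityMeasure (gibbs σ a θ u₀ N Φ) := hP N Φ
  have hinv : ∀ t, MeasurePreserving (Φ.flow t) (gibbs σ a θ u₀ N Φ) (gibbs σ a θ u₀ N Φ) := fun t =>
    measurePreserving_flow_localGibbsLaw_const σ a θ u₀ N Φ t
  have hgood : gibbs σ a θ u₀ N Φ Φ.goodᶜ = 0 := by
    have hac : gibbs σ a θ u₀ N Φ ≪ Literature.Analysis.FluidPDE.liouville
        (Literature.Analysis.FluidPDE.Torus.geometry (Fin 3)) (N + 1) (hsDiameter σ N) := by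
      show localGibbsLaw σ _ _ _ N Φ ≪ _
      rw [Literature.MathematicalPhysics.KineticTheory.localGibbsLaw_eq]
      exact Literature.MathematicalPhysics.KineticTheory.localGibbsMeasure_absolutelyContinuous σ _ _ _ N Φ
    exact hac Φ.measure_compl_good
  set G : Measure (Phase N) := gibbs σ a θ u₀ N Φ with hGdef
  have hHpos : 0 < H := hτ₀.trans_le hH
  set ℓ : ℝ := scale N with hℓdef
  have hℓ : 0 < ℓ := Real.rpow_pos_of_pos (by positivity) _
  set T : ℝ := H * ℓ with hTdef
  have hT : 0 < T := mul_pos hHpos hℓ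
  have hTh : τ₀ * ℓ ≤ T := mul_le_mul_of_nonneg_right hH hℓ.le
  set F : Phase N → ℝ := fluxObs θ u₀ φ g N with hFdef
  have hFc : Continuous F := continuous_fluxObs hφ hg N
  have hFm : Measurable F := measurable_fluxObs hφ hg N
  have hFb : ∀ z, |F z| ≤ (N + 1) * (κ / 4) := abs_fluxObs_le hφ1 hgκ N
  have hF4m : Measurable (fluxObs θ u₀ φ (fun v => 4 * g v) N) := measurable_fluxObs hφ hg4c N
  -- the bound for `Y = 4(A_n − A'_n)` and the Koopman tolerance
  set B : ℝ := 4 * ((N + 1) * (κ / 4) + (N + 1) * (κ / 4)) with hBdef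
  have hε₀pos : 0 < η / (4 * Real.exp B) := by positivity
  have hε₀ : (0 : ℝ≥0∞) < ENNReal.ofReal (η / (4 * Real.exp B)) := ENNReal.ofReal_pos.2 hε₀pos
  obtain ⟨u₁, hu₁, hmod⟩ := exists_shift_modulus Φ G hgood hFc hFb hε₀
  -- the sample threshold
  refine ⟨⌈(T / u₁ + 2) * T / lag⌉₊ + 1, by omega, fun n hn => ?_⟩
  have hn1 : 1 ≤ n := le_trans (by omega) hn
  have hn_pos : (0 : ℝ) < n := by exact_mod_cast hn1
  have hnreal : (T / u₁ + 2) * T / lag ≤ n := by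
    have h1 : ((⌈(T / u₁ + 2) * T / lag⌉₊ : ℕ) : ℝ) ≤ n := by exact_mod_cast (Nat.le_succ _).trans hn
    exact (Nat.le_ceil _).trans h1
  have hnlagT : T / u₁ + 2 ≤ n * lag / T := by
    rw [le_div_iff₀ hT]
    rw [div_le_iff₀ hlag] at hnreal
    linarith
  -- the integer `m` and its bounds
  set m : ℕ := ⌊(n : ℝ) * lag / T⌋₊ with hmdef
  have hm_le : (m : ℝ) ≤ n * lag / T := Nat.floor_le (by positivity)
  have hm_gt : (n : ℝ) * lag / T < m + 1 := Nat.lt_floor_add_one _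
  have hm_big : T / u₁ + 1 < m := by linarith
  have hTu : 0 < T / u₁ := div_pos hT hu₁
  have hm1 : 1 ≤ m := by
    have h1 : (1 : ℝ) < m := by linarith
    exact_mod_cast h1.le
  have hm_pos : (0 : ℝ) < m := by exact_mod_cast hm1
  -- `m·T ≤ n·lag < (m+1)·T`
  have hmT : (m : ℝ) * T ≤ n * lag := by rwa [le_div_iff₀ hT] at hm_le
  have hmT' : (n : ℝ) * lag < (m + 1) * T := by rwa [div_lt_iff₀ hT] at hm_gt
  -- spacings: the window spacing `T/n` is at most the certificate spacing `lag/m`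
  have hss : T / n ≤ lag / m := by
    rw [div_le_div_iff₀ hn_pos hm_pos]
    linarith
  -- offsets are at most `T/m < u₁`
  have hoff1 : (n : ℝ) * (lag / m - T / n) ≤ T / m := by
    have e1 : (n : ℝ) * (lag / m - T / n) = (n * lag - m * T) / m := by field_simp
    rw [e1, div_le_div_iff_of_pos_right hm_pos]
    linarith
  have hoff2 : T / m < u₁ := by
    rw [div_lt_iff₀ hm_pos]
    have h1 : u₁ * (T / u₁ + 1) = T + u₁ := by field_simp
    have h2 := mul_lt_mul_of_pos_left hm_big hu₁
    linarith
  -- the certificate window is at least the cost scale: `τ₀ ℓ ≤ n·lag/m`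
  have hwin : τ₀ * ℓ * m ≤ n * lag := by
    calc τ₀ * ℓ * m ≤ T * m := mul_le_mul_of_nonneg_right hTh hm_pos.le
      _ ≤ n * lag := by linarith [hmT]
  -- (1) the certificate for `4F`
  have cert := discreteCertificate Φ G hinv hgood hF4m hWm hlag hm1 hn1
  have hdef' : ∫⁻ z, ENNReal.ofReal (Real.exp (2 * (fluxObs θ u₀ φ (fun v => 4 * g v) N z -
      lag⁻¹ * (W (Φ.flow lag z) - W z)))) ∂G ≤ ENNReal.ofReal (Real.exp (η * (N + 1))) := hdef
  have hcoef : 4 * (m : ℝ) / (n * lag) ≤ 4 * (τ₀ * ℓ)⁻¹ := by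
    rw [div_le_iff₀ (by positivity)]
    have h1 : (m : ℝ) ≤ (τ₀ * ℓ)⁻¹ * (n * lag) := by
      rw [le_inv_mul_iff₀ (by positivity)]
      linarith
    linarith
  have hcost' : ∫⁻ z, ENNReal.ofReal (Real.exp (4 * m / (n * lag) * |W z|)) ∂G ≤
      ENNReal.ofReal (Real.exp (η * (N + 1))) := by
    refine le_trans (lintegral_mono fun z => ENNReal.ofReal_le_ofReal (Real.exp_le_exp.2
      (mul_le_mul_of_nonneg_right hcoef (abs_nonneg _)))) ?_
    exact hcost
  have hA' : ∫⁻ z, ENNReal.ofReal (Real.exp (4 * discAvg Φ F n (lag / m) z)) ∂G ≤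
      ENNReal.ofReal (Real.exp (η * (N + 1))) := by
    have e1 : ∀ z, 4 * discAvg Φ F n (lag / m) z = discAvg Φ (fluxObs θ u₀ φ (fun v => 4 * g v) N) n (lag / m) z :=
      fun z => (discAvg_fluxObs_const_mul Φ θ u₀ φ g 4 n (lag / m) z).symm
    simp only [e1]
    refine cert.trans ?_
    calc (∫⁻ z, ENNReal.ofReal (Real.exp (2 * (fluxObs θ u₀ φ (fun v => 4 * g v) N z -
            lag⁻¹ * (W (Φ.flow lag z) - W z)))) ∂G) ^ (1 / 2 : ℝ) *
          (∫⁻ z, ENNReal.ofReal (Real.exp (4 * m / (n * lag) * |W z|)) ∂G) ^ (1 / 2 : ℝ)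
        ≤ (ENNReal.ofReal (Real.exp (η * (N + 1)))) ^ (1 / 2 : ℝ) *
            (ENNReal.ofReal (Real.exp (η * (N + 1)))) ^ (1 / 2 : ℝ) :=
          mul_le_mul' (ENNReal.rpow_le_rpow hdef' (by norm_num)) (ENNReal.rpow_le_rpow hcost' (by norm_num))
      _ = ENNReal.ofReal (Real.exp (η * (N + 1))) := by
          rw [← ENNReal.rpow_add_of_nonneg _ _ (by norm_num) (by norm_num)]
          norm_num
  -- (2) the sampling error `Y = 4 (A_n − A'_n)`
  set Y : Phase N → ℝ := fun z => 2 * (2 * (discAvg Φ F n (T / n) z - discAvg Φ F n (lag / m) z)) with hYdef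
  have hAm : Measurable (discAvg Φ F n (T / n)) := measurable_discAvg Φ hFm n _
  have hA'm : Measurable (discAvg Φ F n (lag / m)) := measurable_discAvg Φ hFm n _
  have hYm : Measurable Y := ((hAm.sub hA'm).const_mul 2).const_mul 2
  have hYb : ∀ z, |Y z| ≤ B := by
    intro z
    have h1 := abs_discAvg_le Φ hFb hn1 (T / n) z
    have h2 := abs_discAvg_le Φ hFb hn1 (lag / m) z
    rw [hYdef, hBdef]
    simp only
    rw [abs_mul, abs_mul, abs_two]
    have h3 := abs_sub (discAvg Φ F n (T / n) z) (discAvg Φ F n (lag / m) z)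
    linarith
  have hYint : ∫⁻ z, ENNReal.ofReal |Y z| ∂G ≤ 4 * ENNReal.ofReal (η / (4 * Real.exp B)) := by
    -- pointwise: `|Y| ≤ 4 n⁻¹ Σ_j |F∘Φ_{t_j} − F∘Φ_{t'_j}|`
    have pt : ∀ z, ENNReal.ofReal |Y z| ≤ ENNReal.ofReal (4 * (n : ℝ)⁻¹) *
        ∑ j : Fin n, ENNReal.ofReal |F (Φ.flow ((((j : ℕ) : ℝ) + 1) * (T / n)) z) -
          F (Φ.flow ((((j : ℕ) : ℝ) + 1) * (lag / m)) z)| := by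
      intro z
      have e1 : Y z = 4 * (n : ℝ)⁻¹ * ∑ j : Fin n, (F (Φ.flow ((((j : ℕ) : ℝ) + 1) * (T / n)) z) -
          F (Φ.flow ((((j : ℕ) : ℝ) + 1) * (lag / m)) z)) := by
        rw [hYdef]
        simp only [discAvg, Finset.sum_sub_distrib]
        ring
      have hle : |Y z| ≤ 4 * (n : ℝ)⁻¹ * ∑ j : Fin n, |F (Φ.flow ((((j : ℕ) : ℝ) + 1) * (T / n)) z) -
          F (Φ.flow ((((j : ℕ) : ℝ) + 1) * (lag / m)) z)| := by
        rw [e1, abs_mul, abs_of_pos (by positivity : (0 : ℝ) < 4 * (n : ℝ)⁻¹)]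
        exact mul_le_mul_of_nonneg_left (Finset.abs_sum_le_sum_abs _ _) (by positivity)
      refine (ENNReal.ofReal_le_ofReal hle).trans (le_of_eq ?_)
      rw [ENNReal.ofReal_mul (by positivity), ENNReal.ofReal_sum_of_nonneg (fun j _ => abs_nonneg _)]
    -- each term is a shift modulus at an offset `≤ T/m < u₁`
    have each : ∀ j : Fin n, ∫⁻ z, ENNReal.ofReal |F (Φ.flow ((((j : ℕ) : ℝ) + 1) * (T / n)) z) -
        F (Φ.flow ((((j : ℕ) : ℝ) + 1) * (lag / m)) z)| ∂G ≤ ENNReal.ofReal (η / (4 * Real.exp B)) := by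
      intro j
      set u : ℝ := (((j : ℕ) : ℝ) + 1) * (lag / m - T / n) with hudef
      set t : ℝ := (((j : ℕ) : ℝ) + 1) * (T / n) with htdef
      have hj : (((j : ℕ) : ℝ) + 1) ≤ n := by
        have := j.isLt
        exact_mod_cast this
      have hj0 : (0 : ℝ) < ((j : ℕ) : ℝ) + 1 := by positivity
      have hu0 : 0 ≤ u := mul_nonneg hj0.le (sub_nonneg.2 hss)
      have hu1 : u ≤ u₁ := by
        have h1 : u ≤ (n : ℝ) * (lag / m - T / n) :=
          mul_le_mul_of_nonneg_right hj (sub_nonneg.2 hss)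
        linarith
      have e1 : (((j : ℕ) : ℝ) + 1) * (lag / m) = u + t := by rw [hudef, htdef]; ring
      rw [e1]
      calc ∫⁻ z, ENNReal.ofReal |F (Φ.flow t z) - F (Φ.flow (u + t) z)| ∂G
          = ∫⁻ z, ENNReal.ofReal |F (Φ.flow (u + t) z) - F (Φ.flow t z)| ∂G :=
            lintegral_congr fun z => by rw [abs_sub_comm]
        _ = ∫⁻ z, ENNReal.ofReal |F (Φ.flow u z) - F z| ∂G := lintegral_abs_sub_shift Φ G hinv hgood hFm u t
        _ ≤ ENNReal.ofReal (η / (4 * Real.exp B)) := hmod u ⟨hu0, hu1⟩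
    have hmeas : ∀ j : Fin n, Measurable fun z => ENNReal.ofReal |F (Φ.flow ((((j : ℕ) : ℝ) + 1) * (T / n)) z) -
        F (Φ.flow ((((j : ℕ) : ℝ) + 1) * (lag / m)) z)| := fun j =>
      ((hFm.comp (Φ.measurable_flow _)).sub (hFm.comp (Φ.measurable_flow _))).abs.ennreal_ofReal
    calc ∫⁻ z, ENNReal.ofReal |Y z| ∂G
        ≤ ∫⁻ z, ENNReal.ofReal (4 * (n : ℝ)⁻¹) *
            ∑ j : Fin n, ENNReal.ofReal |F (Φ.flow ((((j : ℕ) : ℝ) + 1) * (T / n)) z) -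
              F (Φ.flow ((((j : ℕ) : ℝ) + 1) * (lag / m)) z)| ∂G := lintegral_mono pt
      _ = ENNReal.ofReal (4 * (n : ℝ)⁻¹) *
            ∑ j : Fin n, ∫⁻ z, ENNReal.ofReal |F (Φ.flow ((((j : ℕ) : ℝ) + 1) * (T / n)) z) -
              F (Φ.flow ((((j : ℕ) : ℝ) + 1) * (lag / m)) z)| ∂G := by
          rw [lintegral_const_mul _ (Finset.measurable_sum _ fun j _ => hmeas j),
            lintegral_finsetSum _ fun j _ => hmeas j]
      _ ≤ ENNReal.ofReal (4 * (n : ℝ)⁻¹) * ∑ _j : Fin n, ENNReal.ofReal (η / (4 * Real.exp B)) :=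
          mul_le_mul' le_rfl (Finset.sum_le_sum fun j _ => each j)
      _ = 4 * ENNReal.ofReal (η / (4 * Real.exp B)) := by
          rw [Finset.sum_const, Finset.card_univ, Fintype.card_fin, nsmul_eq_mul, ← mul_assoc,
            ENNReal.ofReal_mul (by norm_num : (0 : ℝ) ≤ 4), ENNReal.ofReal_ofNat, mul_assoc (4 : ℝ≥0∞),
            ENNReal.ofReal_inv_of_pos hn_pos, ENNReal.ofReal_natCast,
            ENNReal.inv_mul_cancel (by exact_mod_cast hn_pos.ne') (ENNReal.natCast_ne_top n), mul_one]
  have hYexp : ∫⁻ z, ENNReal.ofReal (Real.exp (Y z)) ∂G ≤ ENNReal.ofReal (Real.exp (η * (N + 1))) := by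
    refine (lintegral_exp_le_one_add hYm hYb).trans ?_
    have h1 : ENNReal.ofReal (Real.exp B) * ∫⁻ z, ENNReal.ofReal |Y z| ∂G ≤ ENNReal.ofReal η := by
      refine (mul_le_mul' le_rfl hYint).trans ?_
      rw [← ENNReal.ofReal_ofNat, ← ENNReal.ofReal_mul (by norm_num : (0 : ℝ) ≤ 4),
        ← ENNReal.ofReal_mul (Real.exp_nonneg _)]
      refine ENNReal.ofReal_le_ofReal (le_of_eq ?_)
      field_simp
    calc 1 + ENNReal.ofReal (Real.exp B) * ∫⁻ z, ENNReal.ofReal |Y z| ∂G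
        ≤ 1 + ENNReal.ofReal η := add_le_add le_rfl h1
      _ = ENNReal.ofReal (η + 1) := by rw [ENNReal.ofReal_add hη.le zero_le_one, ENNReal.ofReal_one, add_comm]
      _ ≤ ENNReal.ofReal (Real.exp (η * (N + 1))) := by
          refine ENNReal.ofReal_le_ofReal ((Real.add_one_le_exp η).trans (Real.exp_le_exp.2 ?_))
          have hN0 : (0 : ℝ) ≤ N := Nat.cast_nonneg N
          have hηN : 0 ≤ η * N := mul_nonneg hη.le hN0
          linarith
  -- (3) Cauchy–Schwarz and assembly
  have hfinal : ∫⁻ z, ENNReal.ofReal (Real.exp (2 * discAvg Φ F n (T / n) z)) ∂G ≤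
      ENNReal.ofReal (Real.exp (η * (N + 1))) := by
    have e1 : ∀ z, 2 * discAvg Φ F n (T / n) z =
        2 * discAvg Φ F n (lag / m) z + 2 * (discAvg Φ F n (T / n) z - discAvg Φ F n (lag / m) z) := fun z => by ring
    simp only [e1]
    refine (lintegral_exp_add_le (hA'm.const_mul 2) ((hAm.sub hA'm).const_mul 2)).trans ?_
    have e2 : ∀ z, 2 * (2 * discAvg Φ F n (lag / m) z) = 4 * discAvg Φ F n (lag / m) z := fun z => by ring
    simp only [e2]
    calc (∫⁻ z, ENNReal.ofReal (Real.exp (4 * discAvg Φ F n (lag / m) z)) ∂G) ^ (1 / 2 : ℝ) *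
          (∫⁻ z, ENNReal.ofReal (Real.exp (Y z)) ∂G) ^ (1 / 2 : ℝ)
        ≤ (ENNReal.ofReal (Real.exp (η * (N + 1)))) ^ (1 / 2 : ℝ) *
            (ENNReal.ofReal (Real.exp (η * (N + 1)))) ^ (1 / 2 : ℝ) :=
          mul_le_mul' (ENNReal.rpow_le_rpow hA' (by norm_num)) (ENNReal.rpow_le_rpow hYexp (by norm_num))
      _ = ENNReal.ofReal (Real.exp (η * (N + 1))) := by
          rw [← ENNReal.rpow_add_of_nonneg _ _ (by norm_num) (by norm_num)]
          norm_num
  -- back to the Bochner integral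
  rw [integral_eq_lintegral_of_nonneg_ae (ae_of_all _ fun z => (Real.exp_pos _).le)
    ((hAm.const_mul 2).exp.aestronglyMeasurable)]
  exact ENNReal.toReal_le_of_le_ofReal (Real.exp_pos _).le hfinal

/-- **The line's open stub is implied by the crux** (costume theorem, Lean-closed modulo the TRUE stub 2): with
`OneBodyEntropyBudget` (stub 2 of the line, verbatim), `CorrectorPressureDecay ⇒ FastSectorDominance` (stub 5, verbatim,
with `A = C = 0` at amplitude `κ/8`) — compose `discreteWindowPressureDecay_of_correctorPressureDecay` with drefute gen 2's
`fastSectorDominance_of_discreteWindowPressureDecay`. The converse `FastSectorDominance ⇒ CorrectorPressureDecay`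
(given stubs 1, 2, 3, 6) is the skeleton's own sorry-free composition. [folklore] -/
theorem fastSectorDominance_of_correctorPressureDecay (h₂ : OneBodyEntropyBudget)
    (hX : Summit.AtomisticToContinuum.HydrodynamicLimit.Theses.AntiMazurCoboundaries.CorrectorPressureDecay) :
    FastSectorDominance :=
  fastSectorDominance_of_discreteWindowPressureDecay h₂ (discreteWindowPressureDecay_of_correctorPressureDecay hX)


end Summit.AtomisticToContinuum.HydrodynamicLimit.Theorems.CorrectorPressureDecayNegative.DiscreteWindow

end

/-!
# Negative knowledge for `CorrectorPressureDecay` (stmt-AtomisticToContinuum-14135): window comparison lemmas for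
measure-preserving semigroups (drefute gen 3, file 3/4)

Refuter `refuter-drefute-stmt-AtomisticToContinuum-14135-g3-0`, 2026-08-16. Abstract tools consumed by
`Negative/DiscreteWindowOfKineticFlux.lean` (file 4/4: `KineticFluxLdDecay → DiscreteWindowPressureDecay`, the paper step of
drefute gen 2's sandwich made a Lean theorem). For an everywhere-defined jointly measurable measure-preserving semigroup
`θ` on a probability space and a bounded measurable `F` (sorry-free):

* `lintegral_exp_window_le_of_short` — LONG WINDOWS FROM ONE WINDOW: if `∫ exp(L⁻¹∫₀ᴸ F∘θ_s) dμ ≤ K` (`K ≥ 1`) then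
  `∫ exp(T⁻¹∫₀ᵀ F∘θ_s) dμ ≤ e^{C_F L/T} K` for every `T ≥ L`: `[0, T]` = `⌊T/L⌋` shifted `L`-blocks + a remainder shorter
  than `L`; the remainder enters MULTIPLICATIVELY (`e^{C_F L/T}`), the blocks through convexity of `exp` (weights `mL/T`,
  `1 − mL/T` at the points (block average, 0), then the `m`-point average) and invariance. This replaces the
  Hölder-subadditivity argument `∃τ ⇒ ∀H ≥ H₁` of the 10967 docstring.
* `lintegral_abs_discAvg_sub_window_le` — DISCRETE VS CONTINUOUS averages in `L¹(μ)`: the right-endpoint sample of each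
  block sits to the RIGHT of every point of its block by at most `T/n`, so `∫ |n⁻¹Σ_{j=1}^{n} F∘θ_{jT/n} − T⁻¹∫₀ᵀ F∘θ_u| dμ`
  is bounded by the `L¹` cost of right shifts `≤ T/n` (Tonelli, `lintegral_ofReal_intervalIntegral_abs_le`). No Riemann sums:
  right-continuity of the Koopman shift (file 2/4) makes this small at fixed `(N, Φ)`.
Nothing here asserts a Theses decl.
-/

noncomputable section

open MeasureTheory ProbabilityTheory InformationTheory Set Filter Topology
open scoped ENNReal

namespace Summit.AtomisticToContinuum.HydrodynamicLimit.Theorems.CorrectorPressureDecayNegative.DiscreteWindow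

open Summit.AtomisticToContinuum.HydrodynamicLimit.Theorems.AntiMazurCoboundariesExponentialCertificate
  (intervalIntegrable_of_bounded measurable_intervalIntegral_comp)

section Abstract

variable {X : Type*} [MeasurableSpace X] (θ : ℝ × X → X)

/-- Invariance of the shift modulus for an everywhere-defined measure-preserving semigroup. [folklore] -/
theorem lintegral_abs_sub_shift_semigroup (hθ : ∀ t, Measurable fun z => θ (t, z))
    (hsg : ∀ s t z, θ (s + t, z) = θ (s, θ (t, z))) (μ : Measure X)
    (hinv : ∀ t, MeasurePreserving (fun z => θ (t, z)) μ μ) {F : X → ℝ} (hF : Measurable F) (u t : ℝ) :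
    ∫⁻ z, ENNReal.ofReal |F (θ (u + t, z)) - F (θ (t, z))| ∂μ = ∫⁻ z, ENNReal.ofReal |F (θ (u, z)) - F z| ∂μ := by
  have hm : Measurable fun w => ENNReal.ofReal |F (θ (u, w)) - F w| :=
    ((hF.comp (hθ u)).sub hF).abs.ennreal_ofReal
  simp only [hsg]
  exact (hinv t).lintegral_comp hm

/-- Window integrals of a two-point difference are measurable in the initial datum (joint measurability). [folklore] -/
theorem measurable_intervalIntegral_abs_sub (hθ : Measurable θ) {F : X → ℝ} (hF : Measurable F) (t : ℝ)
    {a b : ℝ} (hab : a ≤ b) : Measurable fun z => ∫ u in a..b, |F (θ (t, z)) - F (θ (u, z))| := by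
  simp only [intervalIntegral.integral_of_le hab]
  have hθt : Measurable fun z => θ (t, z) := hθ.comp measurable_prodMk_left
  have hsm : StronglyMeasurable fun p : ℝ × X => |F (θ (t, p.2)) - F (θ p)| :=
    ((hF.comp (hθt.comp measurable_snd)).sub (hF.comp hθ)).abs.stronglyMeasurable
  exact (hsm.integral_prod_left' (μ := volume.restrict (Ioc a b))).measurable

/-- **Tonelli for the shift modulus**: if `∫ |F∘θ_t − F∘θ_u| dμ ≤ ε` for all `u ∈ [a, b]` then
`∫ (∫_a^b |F∘θ_t − F∘θ_u| du) dμ ≤ (b − a) ε`. [folklore] -/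
theorem lintegral_ofReal_intervalIntegral_abs_le (hθ : Measurable θ) (μ : Measure X) [SFinite μ]
    {F : X → ℝ} (hF : Measurable F) {CF : ℝ} (hCF : ∀ z, |F z| ≤ CF) (t : ℝ) {a b : ℝ} (hab : a ≤ b)
    {ε : ℝ≥0∞} (hε : ∀ u ∈ Icc a b, ∫⁻ z, ENNReal.ofReal |F (θ (t, z)) - F (θ (u, z))| ∂μ ≤ ε) :
    ∫⁻ z, ENNReal.ofReal (∫ u in a..b, |F (θ (t, z)) - F (θ (u, z))|) ∂μ ≤ ENNReal.ofReal (b - a) * ε := by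
  have hθs : ∀ z, Measurable fun s : ℝ => θ (s, z) := fun z => hθ.comp measurable_prodMk_right
  have hθt : Measurable fun z => θ (t, z) := hθ.comp measurable_prodMk_left
  have hdm : ∀ z, Measurable fun u : ℝ => |F (θ (t, z)) - F (θ (u, z))| := fun z =>
    (measurable_const.sub (hF.comp (hθs z))).abs
  have hdb : ∀ z u, |(|F (θ (t, z)) - F (θ (u, z))|)| ≤ CF + CF := fun z u => by
    rw [abs_abs]; exact (abs_sub _ _).trans (add_le_add (hCF _) (hCF _))
  have step1 : ∀ z, ENNReal.ofReal (∫ u in a..b, |F (θ (t, z)) - F (θ (u, z))|) =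
      ∫⁻ u in Ioc a b, ENNReal.ofReal |F (θ (t, z)) - F (θ (u, z))| := by
    intro z
    rw [intervalIntegral.integral_of_le hab]
    refine ofReal_integral_eq_lintegral_ofReal ?_ (ae_of_all _ fun u => abs_nonneg _)
    exact (intervalIntegrable_of_bounded (hdm z) (hdb z) a b).1
  simp only [step1]
  have hm2 : Measurable (Function.uncurry fun (z : X) (u : ℝ) => ENNReal.ofReal |F (θ (t, z)) - F (θ (u, z))|) := by
    have h1 : Measurable fun p : X × ℝ => F (θ (t, p.1)) := hF.comp (hθt.comp measurable_fst)
    have h2 : Measurable fun p : X × ℝ => F (θ (p.2, p.1)) := hF.comp (hθ.comp measurable_swap)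
    exact (h1.sub h2).abs.ennreal_ofReal
  rw [lintegral_lintegral_swap (μ := μ) (ν := volume.restrict (Ioc a b)) hm2.aemeasurable]
  calc ∫⁻ u in Ioc a b, ∫⁻ z, ENNReal.ofReal |F (θ (t, z)) - F (θ (u, z))| ∂μ
      ≤ ∫⁻ _u in Ioc a b, ε := setLIntegral_mono' measurableSet_Ioc fun u hu => hε u ⟨hu.1.le, hu.2⟩
    _ = ENNReal.ofReal (b - a) * ε := by rw [setLIntegral_const, Real.volume_Ioc, mul_comm]

/-- **Discrete versus continuous window averages in `L¹`**: if every right shift by at most `T/n` costs at most `ε`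
in `L¹(μ)`, then `∫ |n⁻¹ Σ_{j=1}^{n} F∘θ_{jT/n} − T⁻¹∫₀ᵀ F∘θ_u du| dμ ≤ ε`. [folklore] -/
theorem lintegral_abs_discAvg_sub_window_le (hθ : Measurable θ) (μ : Measure X) [SFinite μ]
    {F : X → ℝ} (hF : Measurable F) {CF : ℝ} (hCF : ∀ z, |F z| ≤ CF) {T : ℝ} (hT : 0 < T) {n : ℕ} (hn : 1 ≤ n)
    {ε : ℝ≥0∞} (hε : ∀ t u : ℝ, 0 ≤ u → u ≤ t → t ≤ u + T / n →
      ∫⁻ z, ENNReal.ofReal |F (θ (t, z)) - F (θ (u, z))| ∂μ ≤ ε) :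
    ∫⁻ z, ENNReal.ofReal |(n : ℝ)⁻¹ * ∑ j : Fin n, F (θ ((((j : ℕ) : ℝ) + 1) * (T / n), z)) -
        T⁻¹ * ∫ u in (0 : ℝ)..T, F (θ (u, z))| ∂μ ≤ ε := by
  have hn' : (0 : ℝ) < n := by exact_mod_cast hn
  set s : ℝ := T / n with hs_def
  have hs : 0 < s := div_pos hT hn'
  have hns : (n : ℝ) * s = T := by rw [hs_def]; field_simp
  have hθs : ∀ z, Measurable fun u : ℝ => θ (u, z) := fun z => hθ.comp measurable_prodMk_right
  have hForb : ∀ z (a b : ℝ), IntervalIntegrable (fun u => F (θ (u, z))) volume a b := fun z a b =>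
    intervalIntegrable_of_bounded (hF.comp (hθs z)) (fun u => hCF _) a b
  -- block decomposition of the window integral
  have hsplit : ∀ z, ∫ u in (0 : ℝ)..T, F (θ (u, z)) =
      ∑ j ∈ Finset.range n, ∫ u in ((j : ℝ) * s)..(((j + 1 : ℕ) : ℝ) * s), F (θ (u, z)) := by
    intro z
    have h := intervalIntegral.sum_integral_adjacent_intervals (a := fun k : ℕ => (k : ℝ) * s) (n := n)
      (fun k _ => hForb z _ _)
    simp only [Nat.cast_zero, zero_mul] at h
    rw [hns] at h
    exact h.symm
  -- the pathwise bound
  have pt : ∀ z, |(n : ℝ)⁻¹ * ∑ j : Fin n, F (θ ((((j : ℕ) : ℝ) + 1) * s, z)) - T⁻¹ * ∫ u in (0 : ℝ)..T, F (θ (u, z))| ≤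
      (n : ℝ)⁻¹ * ∑ j : Fin n, s⁻¹ *
        ∫ u in (((j : ℕ) : ℝ) * s)..((((j : ℕ) : ℝ) + 1) * s), |F (θ ((((j : ℕ) : ℝ) + 1) * s, z)) - F (θ (u, z))| := by
    intro z
    have hT' : T⁻¹ = (n : ℝ)⁻¹ * s⁻¹ := by rw [← hns, mul_inv]
    have e1 : T⁻¹ * ∫ u in (0 : ℝ)..T, F (θ (u, z)) =
        (n : ℝ)⁻¹ * ∑ j : Fin n, s⁻¹ * ∫ u in (((j : ℕ) : ℝ) * s)..((((j : ℕ) : ℝ) + 1) * s), F (θ (u, z)) := by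
      rw [hsplit z, hT', mul_assoc, Finset.mul_sum, ← Fin.sum_univ_eq_sum_range]
      congr 1
      refine Finset.sum_congr rfl fun j _ => ?_
      push_cast
      ring_nf
    have e2 : ∀ j : Fin n, F (θ ((((j : ℕ) : ℝ) + 1) * s, z)) =
        s⁻¹ * ∫ _u in (((j : ℕ) : ℝ) * s)..((((j : ℕ) : ℝ) + 1) * s), F (θ ((((j : ℕ) : ℝ) + 1) * s, z)) := by
      intro j
      rw [intervalIntegral.integral_const, smul_eq_mul]
      have : (((j : ℕ) : ℝ) + 1) * s - ((j : ℕ) : ℝ) * s = s := by ring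
      rw [this, ← mul_assoc, inv_mul_cancel₀ hs.ne', one_mul]
    have e3 : (n : ℝ)⁻¹ * ∑ j : Fin n, F (θ ((((j : ℕ) : ℝ) + 1) * s, z)) - T⁻¹ * ∫ u in (0 : ℝ)..T, F (θ (u, z)) =
        (n : ℝ)⁻¹ * ∑ j : Fin n, s⁻¹ *
          ∫ u in (((j : ℕ) : ℝ) * s)..((((j : ℕ) : ℝ) + 1) * s), (F (θ ((((j : ℕ) : ℝ) + 1) * s, z)) - F (θ (u, z))) := by
      rw [e1, ← mul_sub, ← Finset.sum_sub_distrib]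
      congr 1
      refine Finset.sum_congr rfl fun j _ => ?_
      rw [intervalIntegral.integral_sub intervalIntegrable_const (hForb z _ _), mul_sub, ← e2 j]
    rw [e3, abs_mul, abs_of_pos (inv_pos.2 hn')]
    refine mul_le_mul_of_nonneg_left ((Finset.abs_sum_le_sum_abs _ _).trans (Finset.sum_le_sum fun j _ => ?_))
      (inv_pos.2 hn').le
    rw [abs_mul, abs_of_pos (inv_pos.2 hs)]
    refine mul_le_mul_of_nonneg_left (intervalIntegral.abs_integral_le_integral_abs ?_) (inv_pos.2 hs).le
    nlinarith
  -- integrate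
  have hI0 : ∀ z (j : Fin n), 0 ≤ ∫ u in (((j : ℕ) : ℝ) * s)..((((j : ℕ) : ℝ) + 1) * s),
      |F (θ ((((j : ℕ) : ℝ) + 1) * s, z)) - F (θ (u, z))| := fun z j =>
    intervalIntegral.integral_nonneg (by nlinarith) fun u _ => abs_nonneg _
  have hIm : ∀ j : Fin n, Measurable fun z => ENNReal.ofReal (∫ u in (((j : ℕ) : ℝ) * s)..((((j : ℕ) : ℝ) + 1) * s),
      |F (θ ((((j : ℕ) : ℝ) + 1) * s, z)) - F (θ (u, z))|) := fun j =>
    ENNReal.measurable_ofReal.comp (measurable_intervalIntegral_abs_sub θ hθ hF _ (by nlinarith))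
  have each : ∀ j : Fin n, ∫⁻ z, ENNReal.ofReal (∫ u in (((j : ℕ) : ℝ) * s)..((((j : ℕ) : ℝ) + 1) * s),
      |F (θ ((((j : ℕ) : ℝ) + 1) * s, z)) - F (θ (u, z))|) ∂μ ≤ ENNReal.ofReal s * ε := by
    intro j
    have hj0 : (0 : ℝ) ≤ ((j : ℕ) : ℝ) * s := by positivity
    have h := lintegral_ofReal_intervalIntegral_abs_le θ hθ μ hF hCF ((((j : ℕ) : ℝ) + 1) * s)
      (by nlinarith : ((j : ℕ) : ℝ) * s ≤ (((j : ℕ) : ℝ) + 1) * s) (ε := ε) fun u hu =>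
        hε _ _ (hj0.trans hu.1) hu.2 (by linarith [hu.1])
    have e : (((j : ℕ) : ℝ) + 1) * s - ((j : ℕ) : ℝ) * s = s := by ring
    rwa [e] at h
  calc ∫⁻ z, ENNReal.ofReal |(n : ℝ)⁻¹ * ∑ j : Fin n, F (θ ((((j : ℕ) : ℝ) + 1) * s, z)) -
          T⁻¹ * ∫ u in (0 : ℝ)..T, F (θ (u, z))| ∂μ
      ≤ ∫⁻ z, ENNReal.ofReal ((n : ℝ)⁻¹) * ∑ j : Fin n, (ENNReal.ofReal s⁻¹ *
          ENNReal.ofReal (∫ u in (((j : ℕ) : ℝ) * s)..((((j : ℕ) : ℝ) + 1) * s),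
            |F (θ ((((j : ℕ) : ℝ) + 1) * s, z)) - F (θ (u, z))|)) ∂μ := by
        refine lintegral_mono fun z => (ENNReal.ofReal_le_ofReal (pt z)).trans (le_of_eq ?_)
        rw [ENNReal.ofReal_mul (inv_pos.2 hn').le, ENNReal.ofReal_sum_of_nonneg fun j _ =>
          mul_nonneg (inv_pos.2 hs).le (hI0 z j)]
        congr 1
        exact Finset.sum_congr rfl fun j _ => by rw [ENNReal.ofReal_mul (inv_pos.2 hs).le]
    _ = ENNReal.ofReal ((n : ℝ)⁻¹) * ∑ j : Fin n, (ENNReal.ofReal s⁻¹ *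
          ∫⁻ z, ENNReal.ofReal (∫ u in (((j : ℕ) : ℝ) * s)..((((j : ℕ) : ℝ) + 1) * s),
            |F (θ ((((j : ℕ) : ℝ) + 1) * s, z)) - F (θ (u, z))|) ∂μ) := by
        rw [lintegral_const_mul _ (Finset.measurable_sum _ fun j _ => (hIm j).const_mul _),
          lintegral_finsetSum _ fun j _ => (hIm j).const_mul _]
        congr 1
        exact Finset.sum_congr rfl fun j _ => by rw [lintegral_const_mul _ (hIm j)]
    _ ≤ ENNReal.ofReal ((n : ℝ)⁻¹) * ∑ _j : Fin n, (ENNReal.ofReal s⁻¹ * (ENNReal.ofReal s * ε)) :=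
        mul_le_mul' le_rfl (Finset.sum_le_sum fun j _ => mul_le_mul' le_rfl (each j))
    _ = ε := by
        rw [← mul_assoc, ← ENNReal.ofReal_mul (inv_pos.2 hs).le, inv_mul_cancel₀ hs.ne', ENNReal.ofReal_one,
          one_mul, Finset.sum_const, Finset.card_univ, Fintype.card_fin, nsmul_eq_mul, ← mul_assoc,
          ENNReal.ofReal_inv_of_pos hn', ENNReal.ofReal_natCast,
          ENNReal.inv_mul_cancel (by exact_mod_cast hn'.ne') (ENNReal.natCast_ne_top n), one_mul]

/-- **Long windows from one window.** For an everywhere-defined jointly measurable measure-preserving semigroup, a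
measurable `|F| ≤ C_F`, `0 < L ≤ T` and `1 ≤ K`: if `∫ exp(L⁻¹∫₀ᴸ F∘θ_s ds) dμ ≤ K` then
`∫ exp(T⁻¹∫₀ᵀ F∘θ_s ds) dμ ≤ e^{C_F L/T} · K` — `[0,T]` = `m = ⌊T/L⌋` blocks (each a shifted `L`-window) + a remainder
shorter than `L` (a multiplicative factor `e^{C_F L/T}`); convexity of `exp` with weights `mL/T, 1 − mL/T` at the points
(block average, `0`) and on the `m` blocks; invariance. [folklore] -/
theorem lintegral_exp_window_le_of_short (hθ : Measurable θ) (hsg : ∀ s t z, θ (s + t, z) = θ (s, θ (t, z)))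
    (μ : Measure X) [IsProbabilityMeasure μ] (hinv : ∀ t, MeasurePreserving (fun z => θ (t, z)) μ μ)
    {F : X → ℝ} (hF : Measurable F) {CF : ℝ} (hCF : ∀ z, |F z| ≤ CF) {L T : ℝ} (hL : 0 < L) (hLT : L ≤ T)
    {K : ℝ≥0∞} (hK1 : 1 ≤ K) (hK : ∫⁻ z, ENNReal.ofReal (Real.exp (L⁻¹ * ∫ s in (0 : ℝ)..L, F (θ (s, z)))) ∂μ ≤ K) :
    ∫⁻ z, ENNReal.ofReal (Real.exp (T⁻¹ * ∫ s in (0 : ℝ)..T, F (θ (s, z)))) ∂μ ≤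
      ENNReal.ofReal (Real.exp (CF * L / T)) * K := by
  have hT : 0 < T := hL.trans_le hLT
  have hθt : ∀ t, Measurable fun z => θ (t, z) := fun t => hθ.comp measurable_prodMk_left
  have hθs : ∀ z, Measurable fun u : ℝ => θ (u, z) := fun z => hθ.comp measurable_prodMk_right
  have hForb : ∀ z (a b : ℝ), IntervalIntegrable (fun u => F (θ (u, z))) volume a b := fun z a b =>
    intervalIntegrable_of_bounded (hF.comp (hθs z)) (fun u => hCF _) a b
  -- the integer number of blocks and the remainder
  set m : ℕ := ⌊T / L⌋₊ with hm_def
  have hTL1 : 1 ≤ T / L := by rw [le_div_iff₀ hL, one_mul]; exact hLT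
  have hm1 : 1 ≤ m := by
    have h := Nat.floor_le_floor hTL1
    rwa [Nat.floor_one] at h
  have hm' : (0 : ℝ) < m := by exact_mod_cast hm1
  have hm_le : (m : ℝ) ≤ T / L := Nat.floor_le (by positivity)
  have hm_gt : T / L < m + 1 := Nat.lt_floor_add_one _
  have hmL : (m : ℝ) * L ≤ T := by rwa [le_div_iff₀ hL] at hm_le
  have hmL' : T < (m + 1) * L := by rwa [div_lt_iff₀ hL] at hm_gt
  -- the weight of the blocks
  set w : ℝ := m * L / T with hw_def
  have hw0 : 0 ≤ w := by positivity
  have hw1 : w ≤ 1 := by rw [hw_def, div_le_one hT]; exact hmL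
  -- window averages
  set avgL : X → ℝ := fun z => L⁻¹ * ∫ s in (0 : ℝ)..L, F (θ (s, z)) with havgL
  have havgLm : Measurable avgL := (measurable_intervalIntegral_comp θ hθ hF hL.le).const_mul _
  -- block decomposition: `∫_0^T = Σ_{k<m} L · avgL (θ_{kL} z) + ∫_{mL}^T`
  have hsplit : ∀ z, ∫ s in (0 : ℝ)..T, F (θ (s, z)) =
      L * ∑ k : Fin m, avgL (θ (((k : ℕ) : ℝ) * L, z)) + ∫ s in ((m : ℝ) * L)..T, F (θ (s, z)) := by
    intro z
    have h1 := intervalIntegral.sum_integral_adjacent_intervals (a := fun k : ℕ => (k : ℝ) * L) (n := m)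
      (fun k _ => hForb z _ _)
    simp only [Nat.cast_zero, zero_mul] at h1
    have hblock : ∀ k : ℕ, ∫ s in ((k : ℝ) * L)..(((k + 1 : ℕ) : ℝ) * L), F (θ (s, z)) = L * avgL (θ ((k : ℝ) * L, z)) := by
      intro k
      have e1 : ∫ s in (0 : ℝ)..L, F (θ (s, θ ((k : ℝ) * L, z))) = ∫ s in (0 : ℝ)..L, F (θ (s + (k : ℝ) * L, z)) := by
        refine intervalIntegral.integral_congr fun s _ => ?_
        simp only [hsg]
      rw [havgL]
      simp only
      rw [← mul_assoc, mul_inv_cancel₀ hL.ne', one_mul, e1,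
        intervalIntegral.integral_comp_add_right (fun x => F (θ (x, z))) ((k : ℝ) * L), zero_add]
      congr 1
      push_cast
      ring
    rw [← intervalIntegral.integral_add_adjacent_intervals (hForb z 0 ((m : ℝ) * L)) (hForb z _ T), ← h1,
      Finset.mul_sum, ← Fin.sum_univ_eq_sum_range]
    congr 1
    exact Finset.sum_congr rfl fun k _ => hblock k
  -- the remainder is small
  have hrem : ∀ z, |T⁻¹ * ∫ s in ((m : ℝ) * L)..T, F (θ (s, z))| ≤ CF * L / T := by
    intro z
    have hCF0 : 0 ≤ CF := (abs_nonneg _).trans (hCF z)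
    have h1 : ‖∫ s in ((m : ℝ) * L)..T, F (θ (s, z))‖ ≤ CF * |T - m * L| :=
      intervalIntegral.norm_integral_le_of_norm_le_const fun s _ => by
        rw [Real.norm_eq_abs]; exact hCF _
    rw [Real.norm_eq_abs] at h1
    rw [abs_mul, abs_of_pos (inv_pos.2 hT)]
    have h2 : |T - m * L| ≤ L := by
      rw [abs_of_nonneg (by linarith)]
      linarith
    calc T⁻¹ * |∫ s in ((m : ℝ) * L)..T, F (θ (s, z))| ≤ T⁻¹ * (CF * L) :=
          mul_le_mul_of_nonneg_left (h1.trans (mul_le_mul_of_nonneg_left h2 hCF0)) (inv_pos.2 hT).le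
      _ = CF * L / T := by ring
  -- pointwise bound
  have pt : ∀ z, Real.exp (T⁻¹ * ∫ s in (0 : ℝ)..T, F (θ (s, z))) ≤
      Real.exp (CF * L / T) * (w * ((m : ℝ)⁻¹ * ∑ k : Fin m, Real.exp (avgL (θ (((k : ℕ) : ℝ) * L, z)))) + (1 - w)) := by
    intro z
    set Z : ℝ := (m : ℝ)⁻¹ * ∑ k : Fin m, avgL (θ (((k : ℕ) : ℝ) * L, z)) with hZ
    have e1 : T⁻¹ * ∫ s in (0 : ℝ)..T, F (θ (s, z)) = w * Z + T⁻¹ * ∫ s in ((m : ℝ) * L)..T, F (θ (s, z)) := by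
      rw [hsplit z, mul_add, hZ, hw_def]
      congr 1
      field_simp
    rw [e1, Real.exp_add, mul_comm]
    refine mul_le_mul ((Real.exp_le_exp.2 ((le_abs_self _).trans (hrem z)))) ?_ (Real.exp_nonneg _)
      (Real.exp_nonneg _)
    have hconv := convexOn_exp.2 (Set.mem_univ Z) (Set.mem_univ (0 : ℝ)) hw0 (sub_nonneg.2 hw1) (by ring)
    simp only [smul_eq_mul, mul_zero, add_zero, Real.exp_zero, mul_one] at hconv
    refine hconv.trans (add_le_add (mul_le_mul_of_nonneg_left ?_ hw0) le_rfl)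
    rw [hZ]
    exact exp_avg_le hm1 _
  -- integrate
  have hEm : Measurable fun z => Real.exp (avgL z) := havgLm.exp
  have hI : ∫⁻ z, ENNReal.ofReal ((m : ℝ)⁻¹ * ∑ k : Fin m, Real.exp (avgL (θ (((k : ℕ) : ℝ) * L, z)))) ∂μ =
      ∫⁻ z, ENNReal.ofReal (Real.exp (avgL z)) ∂μ :=
    lintegral_avg_comp_eq θ hθt μ hinv hEm (fun z => Real.exp_nonneg _) hm1 (fun k : Fin m => ((k : ℕ) : ℝ) * L)
  have hnn : ∀ z, 0 ≤ (m : ℝ)⁻¹ * ∑ k : Fin m, Real.exp (avgL (θ (((k : ℕ) : ℝ) * L, z))) := fun z =>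
    mul_nonneg (inv_nonneg.2 hm'.le) (Finset.sum_nonneg fun k _ => Real.exp_nonneg _)
  have hSm : Measurable fun z => ENNReal.ofReal ((m : ℝ)⁻¹ * ∑ k : Fin m, Real.exp (avgL (θ (((k : ℕ) : ℝ) * L, z)))) :=
    ENNReal.measurable_ofReal.comp ((Finset.measurable_sum _ fun k _ => (havgLm.comp (hθt _)).exp).const_mul _)
  have hK' : ∫⁻ z, ENNReal.ofReal (Real.exp (avgL z)) ∂μ ≤ K := by
    refine le_of_eq_of_le (lintegral_congr fun z => ?_) hK
    rw [havgL]
  calc ∫⁻ z, ENNReal.ofReal (Real.exp (T⁻¹ * ∫ s in (0 : ℝ)..T, F (θ (s, z)))) ∂μ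
      ≤ ∫⁻ z, ENNReal.ofReal (Real.exp (CF * L / T)) * (ENNReal.ofReal w *
          ENNReal.ofReal ((m : ℝ)⁻¹ * ∑ k : Fin m, Real.exp (avgL (θ (((k : ℕ) : ℝ) * L, z)))) +
            ENNReal.ofReal (1 - w)) ∂μ := by
        refine lintegral_mono fun z => (ENNReal.ofReal_le_ofReal (pt z)).trans (le_of_eq ?_)
        rw [ENNReal.ofReal_mul (Real.exp_nonneg _), ENNReal.ofReal_add (mul_nonneg hw0 (hnn z)) (sub_nonneg.2 hw1),
          ENNReal.ofReal_mul hw0]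
    _ = ENNReal.ofReal (Real.exp (CF * L / T)) * (ENNReal.ofReal w *
          ∫⁻ z, ENNReal.ofReal ((m : ℝ)⁻¹ * ∑ k : Fin m, Real.exp (avgL (θ (((k : ℕ) : ℝ) * L, z)))) ∂μ +
            ENNReal.ofReal (1 - w)) := by
        have hm3 : Measurable fun z => ENNReal.ofReal w *
            ENNReal.ofReal ((m : ℝ)⁻¹ * ∑ k : Fin m, Real.exp (avgL (θ (((k : ℕ) : ℝ) * L, z)))) +
              ENNReal.ofReal (1 - w) := (hSm.const_mul _).add measurable_const
        have hm4 : Measurable fun z => ENNReal.ofReal w *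
            ENNReal.ofReal ((m : ℝ)⁻¹ * ∑ k : Fin m, Real.exp (avgL (θ (((k : ℕ) : ℝ) * L, z)))) := hSm.const_mul _
        rw [lintegral_const_mul _ hm3, lintegral_add_left hm4, lintegral_const_mul _ hSm, lintegral_const,
          measure_univ, mul_one]
    _ ≤ ENNReal.ofReal (Real.exp (CF * L / T)) * (ENNReal.ofReal w * K + ENNReal.ofReal (1 - w) * K) := by
        rw [hI]
        refine mul_le_mul' le_rfl (add_le_add (mul_le_mul' le_rfl hK') ?_)
        exact le_mul_of_one_le_right (zero_le) hK1
    _ = ENNReal.ofReal (Real.exp (CF * L / T)) * K := by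
        rw [← add_mul, ← ENNReal.ofReal_add hw0 (sub_nonneg.2 hw1), add_sub_cancel, ENNReal.ofReal_one, one_mul]

end Abstract

end Summit.AtomisticToContinuum.HydrodynamicLimit.Theorems.CorrectorPressureDecayNegative.DiscreteWindow

end

/-!
# Negative knowledge for `CorrectorPressureDecay` (stmt-AtomisticToContinuum-14135): the shared wall 10967 implies
discrete-window pressure decay (drefute gen 3, file 4/4)

Refuter `refuter-drefute-stmt-AtomisticToContinuum-14135-g3-0`, 2026-08-16. WHAT IS PROVED (sorry-free):

  `discreteWindowPressureDecay_of_kineticFluxLdDecay : KineticFluxLdDecay → DiscreteWindowPressureDecay`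

(`KineticFluxLdDecay` = stmt-AtomisticToContinuum-10967 BY NAME; `DiscreteWindowPressureDecay` = drefute gen 2's statement
in `Negative/FastSectorSandwichFrame.lean`). This was the PAPER step (i) of drefute gen 2's sandwich; now the chain
`10967 ⇒ DWPD ⇒ stub_fastSectorDominance` is a Lean theorem modulo the true stub 2
(`fastSectorDominance_of_discreteWindowPressureDecay`), and with the landed stub 6 `stub_discreteFejerCorrector` (DWPD ⇒ X)
and `pressureCertificateTransfer_proof` (X ⇒ 10967) the two cruxes stmt-14135 (`CorrectorPressureDecay`) and stmt-10967
are EQUIVALENT by composing kernel-checked theorems: X is the wall in corrector clothing, nothing more and nothing less.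

MECHANISM (no Riemann sums, no subadditivity): apply 10967 to the admissible observable `4g` at `δ := η/2` (window `τ`,
threshold `N₀`), put `H₁ := max τ (2κτ/η)`; for `H ≥ H₁`: the long-window lemma of file 3/4 on the modified flow
`flowMod Φ` gives `∫ exp(4 Ā_{Hℓ_N}) dG_N ≤ e^{(N+1)κτ/H} e^{η(N+1)/2} ≤ e^{η(N+1)}`; for `n ≥ n₀(N, Φ)` (`Hℓ_N/n ≤ u₁`, the
Koopman tolerance of file 2/4) the discrete average is `L¹(G_N)`-close to `Ā_{Hℓ_N}`, `∫ e^{4(A_n − Ā)} ≤ e^{η(N+1)}`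
(`∫e^Y ≤ 1 + e^B∫|Y|`), and Cauchy–Schwarz assembles `∫ exp(2A_n) dG_N ≤ e^{η(N+1)}`. Nothing here asserts a Theses decl.
-/

noncomputable section

open MeasureTheory ProbabilityTheory InformationTheory Set Filter Topology
open scoped ENNReal

namespace Summit.AtomisticToContinuum.HydrodynamicLimit.Theorems.CorrectorPressureDecayNegative.DiscreteWindow

open Literature.MathematicalPhysics.KineticTheory (T3 V3 hsDiameter localGibbsLaw)
open Literature.Analysis.FluidPDE (HardSphereFlow Config)
open Summit.AtomisticToContinuum.HydrodynamicLimit.Theorems.CorrectorPressureDecayNegative.FastSectorSandwich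
open Summit.AtomisticToContinuum.HydrodynamicLimit.Theorems.BoltzmannGreenKuboOrthMomentum
  (flowMod flowMod_of_mem measurable_flowMod)
open Summit.AtomisticToContinuum.HydrodynamicLimit.Theorems.AntiMazurCoboundariesExponentialCertificate
  (flowMod_add measurePreserving_flowMod intervalIntegrable_of_bounded measurable_intervalIntegral_comp)

/-! ## The wall implies discrete-window pressure decay -/

section Main

variable {σ : ℝ} {N : ℕ}

set_option maxHeartbeats 1600000 in
/-- **10967 ⇒ discrete-window pressure decay.** `KineticFluxLdDecay` (stmt-10967, BY NAME) implies
`DiscreteWindowPressureDecay` at amplitude `κ/4`: apply 10967 to the admissible observable `4g` at `δ := η/2`, giving a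
window `τ` and `N₀`; put `H₁ := max τ (2κτ/η)`. For `H ≥ H₁`, `N ≥ N₀` and a flow: the long-window lemma turns the
`τℓ_N`-window bound into `∫ exp(4Ā_{Hℓ_N}) dG_N ≤ e^{η(N+1)}` (remainder factor `e^{(N+1)κτ/H} ≤ e^{η(N+1)/2}`); for
`n ≥ n₀(N, Φ)` the discrete average `A_n` is `L¹(G_N)`-close to `Ā_{Hℓ_N}` (right-continuity of the Koopman shift), so
`∫ e^{4(A_n − Ā)} ≤ e^{η(N+1)}`, and Cauchy–Schwarz gives `∫ exp(2A_n) dG_N ≤ e^{η(N+1)}`. [folklore] -/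
theorem discreteWindowPressureDecay_of_kineticFluxLdDecay
    (h : Summit.AtomisticToContinuum.HydrodynamicLimit.Theses.AntiMazurCoboundaries.KineticFluxLdDecay) :
    DiscreteWindowPressureDecay := by
  intro a θ u₀ ha hθ
  obtain ⟨σ₀, hσ₀, H⟩ := h a θ u₀ ha hθ
  refine ⟨σ₀, hσ₀, fun σ hσ hσlt => ?_⟩
  obtain ⟨hP, κ, hκ, Hκ⟩ := H σ hσ hσlt
  refine ⟨κ / 4, by positivity, fun φ g hφ hg hφ1 hgκ horth η hη => ?_⟩
  -- the wall for the admissible observable `4g` at `δ := η/2`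
  have hg4c : Continuous fun v => 4 * g v := continuous_const.mul hg
  have hg4b : ∀ v, |4 * g v| ≤ κ := fun v => by
    rw [abs_mul, abs_of_pos (by norm_num : (0 : ℝ) < 4)]
    linarith [hgκ v]
  have hη2 : 0 < η / 2 := by positivity
  obtain ⟨τ, hτ, N₀, HN⟩ := Hκ φ (fun v => 4 * g v) hφ hg4c hφ1 hg4b (orth_const_mul horth 4) (η / 2) hη2
  refine ⟨max τ (2 * κ * τ / η), lt_max_of_lt_left hτ, fun Hw hHw => ⟨N₀, fun N hN Φ => ?_⟩⟩
  have hHτ : τ ≤ Hw := (le_max_left _ _).trans hHw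
  have hHκ : 2 * κ * τ / η ≤ Hw := (le_max_right _ _).trans hHw
  have hHpos : 0 < Hw := hτ.trans_le hHτ
  -- frame objects at fixed `(N, Φ)`
  haveI hGp : IsProbabilityMeasure (gibbs σ a θ u₀ N Φ) := hP N Φ
  have hinv : ∀ t, MeasurePreserving (Φ.flow t) (gibbs σ a θ u₀ N Φ) (gibbs σ a θ u₀ N Φ) := fun t =>
    measurePreserving_flow_localGibbsLaw_const σ a θ u₀ N Φ t
  have hgood : gibbs σ a θ u₀ N Φ Φ.goodᶜ = 0 := by
    have hac : gibbs σ a θ u₀ N Φ ≪ Literature.Analysis.FluidPDE.liouville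
        (Literature.Analysis.FluidPDE.Torus.geometry (Fin 3)) (N + 1) (hsDiameter σ N) := by
      show localGibbsLaw σ _ _ _ N Φ ≪ _
      rw [Literature.MathematicalPhysics.KineticTheory.localGibbsLaw_eq]
      exact Literature.MathematicalPhysics.KineticTheory.localGibbsMeasure_absolutelyContinuous σ _ _ _ N Φ
    exact hac Φ.measure_compl_good
  set G : Measure (Phase N) := gibbs σ a θ u₀ N Φ with hGdef
  have hae : ∀ᵐ z ∂G, z ∈ Φ.good := (mem_ae_iff.2 hgood : Φ.good ∈ ae G)
  set ℓ : ℝ := scale N with hℓdef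
  have hℓ : 0 < ℓ := Real.rpow_pos_of_pos (by positivity) _
  set T : ℝ := Hw * ℓ with hTdef
  have hT : 0 < T := mul_pos hHpos hℓ
  set L : ℝ := τ * ℓ with hLdef
  have hL : 0 < L := mul_pos hτ hℓ
  have hLT : L ≤ T := mul_le_mul_of_nonneg_right hHτ hℓ.le
  set F : Phase N → ℝ := fluxObs θ u₀ φ g N with hFdef
  have hFc : Continuous F := continuous_fluxObs hφ hg N
  have hFm : Measurable F := measurable_fluxObs hφ hg N
  have hFb : ∀ z, |F z| ≤ (N + 1) * (κ / 4) := abs_fluxObs_le hφ1 hgκ N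
  set F₄ : Phase N → ℝ := fluxObs θ u₀ φ (fun v => 4 * g v) N with hF₄def
  have hF4m : Measurable F₄ := measurable_fluxObs hφ hg4c N
  have hF4b : ∀ z, |F₄ z| ≤ (N + 1) * κ := abs_fluxObs_le hφ1 hg4b N
  have hF4eq : ∀ z, F₄ z = 4 * F z := fun z => fluxObs_const_mul θ u₀ φ g 4 N z
  -- the modified flow
  have hθm : Measurable (flowMod Φ) := measurable_flowMod Φ
  have hθmt : ∀ t, Measurable fun z => flowMod Φ (t, z) := fun t => hθm.comp measurable_prodMk_left
  have hinvm : ∀ t, MeasurePreserving (fun z => flowMod Φ (t, z)) G G := measurePreserving_flowMod Φ G hinv hgood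
  -- (1) the wall's window bound, on the modified flow
  set E : ℝ≥0∞ := ENNReal.ofReal (Real.exp (η * (N + 1))) with hEdef
  set Eh : ℝ≥0∞ := ENNReal.ofReal (Real.exp (η / 2 * (N + 1))) with hEhdef
  have h10967 : ∫⁻ z, ENNReal.ofReal (Real.exp (L⁻¹ * ∫ s in (0 : ℝ)..L, F₄ (Φ.flow s z))) ∂G ≤ Eh := HN N hN Φ
  have hKL : ∫⁻ z, ENNReal.ofReal (Real.exp (L⁻¹ * ∫ s in (0 : ℝ)..L, F₄ (flowMod Φ (s, z)))) ∂G ≤ Eh := by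
    refine le_of_eq_of_le (lintegral_congr_ae ?_) h10967
    filter_upwards [hae] with z hz
    simp only [flowMod_of_mem Φ hz]
  -- (2) long windows
  have hEh1 : 1 ≤ Eh := ENNReal.one_le_ofReal.2 (Real.one_le_exp (by positivity))
  have hKT := lintegral_exp_window_le_of_short (flowMod Φ) hθm (flowMod_add Φ) G hinvm hF4m hF4b hL hLT hEh1 hKL
  have hrem : ENNReal.ofReal (Real.exp ((N + 1) * κ * L / T)) * Eh ≤ E := by
    rw [hEhdef, hEdef, ← ENNReal.ofReal_mul (Real.exp_nonneg _), ← Real.exp_add]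
    refine ENNReal.ofReal_le_ofReal (Real.exp_le_exp.2 ?_)
    have hN1 : (0 : ℝ) < N + 1 := by positivity
    have h1 : κ * L / T ≤ η / 2 := by
      rw [hLdef, hTdef, div_le_iff₀ hT]
      have h2 : 2 * κ * τ ≤ Hw * η := by rwa [div_le_iff₀ hη] at hHκ
      nlinarith [mul_le_mul_of_nonneg_right h2 hℓ.le]
    have h3 : (N + 1) * κ * L / T = (N + 1) * (κ * L / T) := by ring
    rw [h3]
    nlinarith [mul_le_mul_of_nonneg_left h1 hN1.le]
  set Abar : Phase N → ℝ := fun z => T⁻¹ * ∫ s in (0 : ℝ)..T, F (flowMod Φ (s, z)) with hAbardef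
  have hAbarm : Measurable Abar := (measurable_intervalIntegral_comp (flowMod Φ) hθm hFm hT.le).const_mul _
  have hAbarb : ∀ z, |Abar z| ≤ (N + 1) * (κ / 4) := by
    intro z
    have h1 : ‖∫ s in (0 : ℝ)..T, F (flowMod Φ (s, z))‖ ≤ (N + 1) * (κ / 4) * |T - 0| :=
      intervalIntegral.norm_integral_le_of_norm_le_const fun s _ => by
        rw [Real.norm_eq_abs]; exact hFb _
    rw [Real.norm_eq_abs, sub_zero, abs_of_pos hT] at h1
    rw [hAbardef]
    simp only
    rw [abs_mul, abs_of_pos (inv_pos.2 hT)]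
    calc T⁻¹ * |∫ s in (0 : ℝ)..T, F (flowMod Φ (s, z))| ≤ T⁻¹ * ((N + 1) * (κ / 4) * T) :=
          mul_le_mul_of_nonneg_left h1 (inv_pos.2 hT).le
      _ = (N + 1) * (κ / 4) := by rw [mul_comm, mul_assoc, mul_inv_cancel₀ hT.ne', mul_one]
  have hA4 : ∫⁻ z, ENNReal.ofReal (Real.exp (4 * Abar z)) ∂G ≤ E := by
    have e1 : ∀ z, 4 * Abar z = T⁻¹ * ∫ s in (0 : ℝ)..T, F₄ (flowMod Φ (s, z)) := by
      intro z
      rw [hAbardef]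
      simp only [hF4eq]
      rw [intervalIntegral.integral_const_mul]
      ring
    simp only [e1]
    exact hKT.trans hrem
  -- (3) the Koopman tolerance and the sample threshold
  set B : ℝ := 4 * ((N + 1) * (κ / 4) + (N + 1) * (κ / 4)) with hBdef
  have hε₀pos : 0 < η / (4 * Real.exp B) := by positivity
  have hε₀ : (0 : ℝ≥0∞) < ENNReal.ofReal (η / (4 * Real.exp B)) := ENNReal.ofReal_pos.2 hε₀pos
  obtain ⟨u₁, hu₁, hmod⟩ := exists_shift_modulus Φ G hgood hFc hFb hε₀
  refine ⟨⌈T / u₁⌉₊ + 1, by omega, fun n hn => ?_⟩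
  have hn1 : 1 ≤ n := le_trans (by omega) hn
  have hn_pos : (0 : ℝ) < n := by exact_mod_cast hn1
  have hTn : T / n ≤ u₁ := by
    have h1 : ((⌈T / u₁⌉₊ : ℕ) : ℝ) ≤ n := by exact_mod_cast (Nat.le_succ _).trans hn
    have h2 : T / u₁ ≤ n := (Nat.le_ceil _).trans h1
    rw [div_le_iff₀ hn_pos]
    rw [div_le_iff₀ hu₁] at h2
    linarith
  -- the shift modulus on the modified flow, for all right shifts by at most `T/n`
  have hεm : ∀ t u : ℝ, 0 ≤ u → u ≤ t → t ≤ u + T / n →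
      ∫⁻ z, ENNReal.ofReal |F (flowMod Φ (t, z)) - F (flowMod Φ (u, z))| ∂G ≤ ENNReal.ofReal (η / (4 * Real.exp B)) := by
    intro t u _ hut htu
    rw [show t = (t - u) + u by ring, lintegral_abs_sub_shift_semigroup (flowMod Φ) hθmt (flowMod_add Φ) G hinvm hFm]
    have e1 : ∫⁻ z, ENNReal.ofReal |F (flowMod Φ (t - u, z)) - F z| ∂G =
        ∫⁻ z, ENNReal.ofReal |F (Φ.flow (t - u) z) - F z| ∂G := by
      refine lintegral_congr_ae ?_
      filter_upwards [hae] with z hz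
      rw [flowMod_of_mem Φ hz]
    rw [e1]
    exact hmod (t - u) ⟨sub_nonneg.2 hut, by linarith⟩
  -- (4) the sampling error `Y = 4 (A_n − Ā)`
  set A : Phase N → ℝ := discAvg Φ F n (T / n) with hAdef
  have hAm : Measurable A := measurable_discAvg Φ hFm n _
  set Y : Phase N → ℝ := fun z => 2 * (2 * (A z - Abar z)) with hYdef
  have hYm : Measurable Y := ((hAm.sub hAbarm).const_mul 2).const_mul 2
  have hYb : ∀ z, |Y z| ≤ B := by
    intro z
    have h1 : |A z| ≤ (N + 1) * (κ / 4) := abs_discAvg_le Φ hFb hn1 (T / n) z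
    have h2 := hAbarb z
    rw [hYdef, hBdef]
    simp only
    rw [abs_mul, abs_mul, abs_two]
    have h3 := abs_sub (A z) (Abar z)
    linarith
  have hL1 : ∫⁻ z, ENNReal.ofReal |A z - Abar z| ∂G ≤ ENNReal.ofReal (η / (4 * Real.exp B)) := by
    have e1 : ∫⁻ z, ENNReal.ofReal |A z - Abar z| ∂G = ∫⁻ z, ENNReal.ofReal
        |(n : ℝ)⁻¹ * ∑ j : Fin n, F (flowMod Φ ((((j : ℕ) : ℝ) + 1) * (T / n), z)) -
          T⁻¹ * ∫ s in (0 : ℝ)..T, F (flowMod Φ (s, z))| ∂G := by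
      refine lintegral_congr_ae ?_
      filter_upwards [hae] with z hz
      simp only [hAdef, hAbardef, discAvg, flowMod_of_mem Φ hz]
    rw [e1]
    exact lintegral_abs_discAvg_sub_window_le (flowMod Φ) hθm G hFm hFb hT hn1 hεm
  have hYint : ∫⁻ z, ENNReal.ofReal |Y z| ∂G ≤ 4 * ENNReal.ofReal (η / (4 * Real.exp B)) := by
    have e1 : ∀ z, ENNReal.ofReal |Y z| = 4 * ENNReal.ofReal |A z - Abar z| := by
      intro z
      rw [hYdef]
      simp only
      rw [← mul_assoc, show (2 : ℝ) * 2 = 4 by norm_num, abs_mul, abs_of_pos (by norm_num : (0 : ℝ) < 4),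
        ENNReal.ofReal_mul (by norm_num : (0 : ℝ) ≤ 4), ENNReal.ofReal_ofNat]
    simp only [e1]
    have hmeas : Measurable fun z => ENNReal.ofReal |A z - Abar z| := (hAm.sub hAbarm).abs.ennreal_ofReal
    rw [lintegral_const_mul _ hmeas]
    exact mul_le_mul' le_rfl hL1
  have hYexp : ∫⁻ z, ENNReal.ofReal (Real.exp (Y z)) ∂G ≤ E := by
    refine (lintegral_exp_le_one_add hYm hYb).trans ?_
    have h1 : ENNReal.ofReal (Real.exp B) * ∫⁻ z, ENNReal.ofReal |Y z| ∂G ≤ ENNReal.ofReal η := by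
      refine (mul_le_mul' le_rfl hYint).trans ?_
      rw [← ENNReal.ofReal_ofNat, ← ENNReal.ofReal_mul (by norm_num : (0 : ℝ) ≤ 4),
        ← ENNReal.ofReal_mul (Real.exp_nonneg _)]
      refine ENNReal.ofReal_le_ofReal (le_of_eq ?_)
      field_simp
    calc 1 + ENNReal.ofReal (Real.exp B) * ∫⁻ z, ENNReal.ofReal |Y z| ∂G
        ≤ 1 + ENNReal.ofReal η := add_le_add le_rfl h1
      _ = ENNReal.ofReal (η + 1) := by rw [ENNReal.ofReal_add hη.le zero_le_one, ENNReal.ofReal_one, add_comm]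
      _ ≤ E := by
          refine ENNReal.ofReal_le_ofReal ((Real.add_one_le_exp η).trans (Real.exp_le_exp.2 ?_))
          have hN0 : (0 : ℝ) ≤ N := Nat.cast_nonneg N
          have hηN : 0 ≤ η * N := mul_nonneg hη.le hN0
          linarith
  -- (5) Cauchy–Schwarz and assembly
  have hfinal : ∫⁻ z, ENNReal.ofReal (Real.exp (2 * A z)) ∂G ≤ E := by
    have e1 : ∀ z, 2 * A z = 2 * Abar z + 2 * (A z - Abar z) := fun z => by ring
    simp only [e1]
    refine (lintegral_exp_add_le (hAbarm.const_mul 2) ((hAm.sub hAbarm).const_mul 2)).trans ?_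
    have e2 : ∀ z, 2 * (2 * Abar z) = 4 * Abar z := fun z => by ring
    simp only [e2]
    calc (∫⁻ z, ENNReal.ofReal (Real.exp (4 * Abar z)) ∂G) ^ (1 / 2 : ℝ) *
          (∫⁻ z, ENNReal.ofReal (Real.exp (Y z)) ∂G) ^ (1 / 2 : ℝ)
        ≤ E ^ (1 / 2 : ℝ) * E ^ (1 / 2 : ℝ) :=
          mul_le_mul' (ENNReal.rpow_le_rpow hA4 (by norm_num)) (ENNReal.rpow_le_rpow hYexp (by norm_num))
      _ = E := by
          rw [← ENNReal.rpow_add_of_nonneg _ _ (by norm_num) (by norm_num)]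
          norm_num
  -- back to the Bochner integral
  rw [integral_eq_lintegral_of_nonneg_ae (ae_of_all _ fun z => (Real.exp_pos _).le)
    ((hAm.const_mul 2).exp.aestronglyMeasurable)]
  exact ENNReal.toReal_le_of_le_ofReal (Real.exp_pos _).le hfinal

end Main

end Summit.AtomisticToContinuum.HydrodynamicLimit.Theorems.CorrectorPressureDecayNegative.DiscreteWindow

end

/-!
# `KineticFluxLdDecay → CorrectorPressureDecay` (the converse of stmt-14139), candidate proof for a PROVER

Refuter `refuter-drefute-stmt-AtomisticToContinuum-14135-g3-0` (drefute gen 3), 2026-08-16 — EVIDENCE, not a refuter landing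
(its conclusion is the crux X positively). Composition of kernel-checked pieces:
`discreteWindowPressureDecay_of_kineticFluxLdDecay` (Negative/DiscreteWindowOfKineticFlux.lean, this seat) and the landed
stub 6 `KineticEntropyCollisionBudget.stub_discreteFejerCorrector` (the lead). Together with
`pressureCertificateTransfer_proof : CorrectorPressureDecay → KineticFluxLdDecay` (stmt-14139, landed) this makes the
cruxes stmt-14135 and stmt-10967 Lean-EQUIVALENT; a planner may file `KineticFluxLdDecay → CorrectorPressureDecay` as a
support item and a prover land this file verbatim.
-/

noncomputable section

open MeasureTheory ProbabilityTheory InformationTheory Set Filter Topology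
open scoped ENNReal

namespace Summit.AtomisticToContinuum.HydrodynamicLimit.Theorems.CorrectorPressureDecayNegative.DiscreteWindow

open Literature.MathematicalPhysics.KineticTheory (T3 V3 hsDiameter localGibbsLaw)
open Literature.Analysis.FluidPDE (HardSphereFlow Config)
open Summit.AtomisticToContinuum.HydrodynamicLimit.Theorems.CorrectorPressureDecayNegative.FastSectorSandwich

set_option maxHeartbeats 800000 in
/-- **Discrete-window pressure decay implies the crux** (quantifier plumbing around the landed stub 6): given `δ`, take
`η := δ`, the window `H := H₁(φ, g, δ)`, `N₀ := N₀(H)`, `τ₀ := 4κ₂H/δ`; for `N ≥ N₀` and a flow take `n := n₀(N, Φ)` and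
`lag := Hℓ_N/n`: the discrete Fejér corrector of stub 6 has both clauses of X. [folklore] -/
theorem correctorPressureDecay_of_discreteWindowPressureDecay (hD : DiscreteWindowPressureDecay) :
    Summit.AtomisticToContinuum.HydrodynamicLimit.Theses.AntiMazurCoboundaries.CorrectorPressureDecay := by
  intro a θ u₀ ha hθ
  obtain ⟨σ₀, hσ₀, HD⟩ := hD a θ u₀ ha hθ
  refine ⟨min σ₀ (1 / 2), lt_min hσ₀ (by norm_num), fun σ hσ hσlt => ?_⟩
  have hσ₀' : σ < σ₀ := lt_of_lt_of_le hσlt (min_le_left _ _)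
  have hσhalf : σ ≤ 1 / 2 := (lt_of_lt_of_le hσlt (min_le_right _ _)).le
  have hP : ∀ (N : ℕ) (Φ : Flow σ N), IsProbabilityMeasure (gibbs σ a θ u₀ N Φ) := fun N Φ =>
    Literature.MathematicalPhysics.KineticTheory.isProbabilityMeasure_localGibbsLaw
      continuous_const continuous_const continuous_const (fun _ => ha) (fun _ => hθ) hσhalf N Φ
  refine ⟨hP, ?_⟩
  obtain ⟨κ₂, hκ₂, Hφ⟩ := HD σ hσ hσ₀'
  refine ⟨κ₂, hκ₂, fun φ g hφ hg hφ1 hgκ horth δ hδ => ?_⟩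
  obtain ⟨H₁, hH₁, HH⟩ := Hφ φ g hφ hg hφ1 hgκ horth δ hδ
  obtain ⟨N₀, HN⟩ := HH H₁ le_rfl
  have hτ₀ : 0 < 4 * κ₂ * H₁ / δ := by positivity
  refine ⟨4 * κ₂ * H₁ / δ, hτ₀, N₀, fun N hN Φ => ?_⟩
  obtain ⟨n₀, hn₀, Hn⟩ := HN N hN Φ
  have hmom := Hn n₀ le_rfl
  haveI := hP N Φ
  have hn₀pos : (0 : ℝ) < n₀ := by exact_mod_cast hn₀
  have hℓ : 0 < scale N := Real.rpow_pos_of_pos (by positivity) _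
  set lag : ℝ := H₁ * scale N / n₀ with hlagdef
  have hlag : 0 < lag := div_pos (mul_pos hH₁ hℓ) hn₀pos
  have hnlag : (n₀ : ℝ) * lag = H₁ * scale N := by rw [hlagdef]; field_simp
  have hcost : 4 * κ₂ * ((n₀ : ℝ) * lag) ≤ δ * ((4 * κ₂ * H₁ / δ) * scale N) := by
    rw [hnlag]
    refine le_of_eq ?_
    field_simp
  -- the Bochner moment bound as a `lintegral` bound
  have hFm : Measurable (fluxObs θ u₀ φ g N) := measurable_fluxObs hφ hg N
  have hAm : Measurable fun z => 2 * discAvg Φ (fluxObs θ u₀ φ g N) n₀ lag z :=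
    (measurable_discAvg Φ hFm n₀ lag).const_mul 2
  have hAb : ∀ z, |2 * discAvg Φ (fluxObs θ u₀ φ g N) n₀ lag z| ≤ 2 * ((N + 1) * κ₂) := fun z => by
    rw [abs_mul, abs_two]
    exact mul_le_mul_of_nonneg_left (abs_discAvg_le Φ (abs_fluxObs_le hφ1 hgκ N) hn₀ lag z) zero_le_two
  have hmomL : ∫⁻ z, ENNReal.ofReal (Real.exp (2 * discAvg Φ (fluxObs θ u₀ φ g N) n₀ lag z)) ∂(gibbs σ a θ u₀ N Φ) ≤
      ENNReal.ofReal (Real.exp (δ * (N + 1))) := by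
    rw [← ofReal_integral_eq_lintegral_ofReal (integrable_exp_of_abs_le hAm hAb)
      (ae_of_all _ fun z => (Real.exp_pos _).le)]
    exact ENNReal.ofReal_le_ofReal hmom
  obtain ⟨W, hWm, hWb, hdef, hcostW⟩ :=
    Summit.AtomisticToContinuum.HydrodynamicLimit.Theorems.KineticEntropyCollisionBudget.stub_discreteFejerCorrector
      σ a θ u₀ hσ hσhalf ha hθ N Φ φ g κ₂ hφ hg hφ1 hgκ n₀ lag δ (4 * κ₂ * H₁ / δ) hn₀ hlag hτ₀ hcost hmomL
  exact ⟨lag, hlag, W, hWm, hWb, hdef, hcostW⟩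

/-- **The wall implies the crux**: `KineticFluxLdDecay → CorrectorPressureDecay` (converse of stmt-14139), by
`discreteWindowPressureDecay_of_kineticFluxLdDecay` and `correctorPressureDecay_of_discreteWindowPressureDecay`. [folklore] -/
theorem correctorPressureDecay_of_kineticFluxLdDecay
    (h : Summit.AtomisticToContinuum.HydrodynamicLimit.Theses.AntiMazurCoboundaries.KineticFluxLdDecay) :
    Summit.AtomisticToContinuum.HydrodynamicLimit.Theses.AntiMazurCoboundaries.CorrectorPressureDecay :=
  correctorPressureDecay_of_discreteWindowPressureDecay (discreteWindowPressureDecay_of_kineticFluxLdDecay h)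

end Summit.AtomisticToContinuum.HydrodynamicLimit.Theorems.CorrectorPressureDecayNegative.DiscreteWindow

end

#print axioms Summit.AtomisticToContinuum.HydrodynamicLimit.Theorems.CorrectorPressureDecayNegative.DiscreteWindow.correctorPressureDecay_of_kineticFluxLdDecay
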